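import Literature.AlgebraicGeometry.Motives.MotivatedCycles
import Literature.AlgebraicGeometry.Motives.PeriodComparison
import HarnessLib

/-!
# de Rham partners of motivated classes (André 1996, §2.4–2.5: Scolie 2.5 and Prop. 2.5.1)

Y. André, *Pour une théorie inconditionnelle des motifs*, Publ. Math. IHÉS 83 (1996) (held:
`paper:doi-10-1007-bf02698643`; printed pp. 17–18):

* **§2.4** (p. 17): for `K` of characteristic `0` the classical cohomologies (étale, de Rham, Betti
  along an embedding into `ℂ`) are comparable Weil cohomologies, and by **Prop. 2.3** "deux
  cohomologies de Weil comparables fournissent des algèbres de cycles motivés canoniquement et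
  fonctoriellement isomorphes", the isomorphism being induced by the comparison isomorphisms (and
  independent of them);
* **§2.5 a), Scolie** (p. 17): "Soit `L/K` une extension séparable (non nécessairement algébrique);
  on suppose `L` séparablement clos. Alors … sous l'isomorphisme canonique
  `H_ét(X_L, ℚ_ℓ) ≅ H_ét(X_{K^sép}, ℚ_ℓ)`, `A_mot(X_L)` s'identifie à `A_mot(X_{K^sép})`. De plus
  `Gal(K^sép/K)` agit sur `A_mot(X_{K^sép})` à travers un groupe fini, et `A_mot(X_K)` est le
  sous-espace des invariants" ("la situation est la même que pour les cycles de Hodge absolus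
  [D82] 2.7, 2.9");
* **§2.5 b)** (p. 18): every element of `A_mot(X) ⊆ H_dR(X)(j)` lies in `F⁰` and is killed by the
  Gauss–Manin connection; **Prop. 2.5.1** (p. 18): "Si `K` est de caractéristique `0`, la collection
  des classes de de Rham et `ℓ`-adiques de tout cycle motivé est un cycle de Hodge absolu au sens de
  [D82] 2.10."

Consequence used by route `HodgeConjecture/PeriodDeficiency` (support item `AndreSandwich`; work
item `wi-23318`), for `k` ALGEBRAICALLY CLOSED of characteristic `0`, `σ : k →+* ℂ`, `X₀/k` smooth
projective: every Betti motivated class `β ∈ A_motᵖ((X₀)_σ) ⊆ H²ᵖ_B((X₀)_σ(ℂ), ℚ)` is the Betti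
component of a motivated cycle `ξ` on `X₀/k` itself (Scolie with `L = ℂ ⊇ σ(k) = σ(k)^sép`,
transported through the étale–Betti and Betti–de Rham comparisons of §2.4, which respect motivated
classes by Prop. 2.3), whose de Rham class `α = cl_dR(ξ) ∈ A_motᵖ(X₀) ⊆ H²ᵖ_dR(X₀/k)` is a
**de Rham partner** of `β`: `c_σ(1 ⊗ α) = (2πi)ᵖ (1 ⊗ β)` for the comparison `c_σ`, and `α` is an
absolute Hodge class (Prop. 2.5.1). For `k = ℚ̄` this is the statement "the de Rham components of
motivated classes on `X_ℂ` are defined over `ℚ̄`" used by Bost–Charles 2014, §2.1 (cf. the design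
note "de Rham partners" of `Motives/MotivatedPeriodTorsor.lean`).

## What this file states

`PeriodRealization.Andre1996_deRhamPartner P` — the above, as a **predicate on a period
realization `P : PeriodRealization k`** (`Motives/PeriodComparison.lean`: de Rham realization
`P.dR`, Betti–Hodge datum `P.B`, comparison `P.iso σ X i`), in the tree's vocabulary
`WeilCohomology.motivatedClasses` (`Motives/MotivatedCycles.lean`, for `P.B.W` on `(X₀)_σ` and for
`P.dR` on `X₀`), `PeriodRealization.IsAbsoluteHodge` (Deligne 1982, Def. 2.10, de Rham form) and
`twoPiI σ`. Exactly as the sibling renderings of André's Thm. 0.4 (`Motives/MotivatedAutPoints.lean`,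
`Andre1996_thm04_completelyReducible / _invariantsMotivated`, predicates on a Betti–Hodge datum):
the theorem in print is this predicate AT THE CLASSICAL period realization over an algebraically
closed `k ⊂ ℂ` (algebraic de Rham cohomology, singular cohomology, Grothendieck's comparison),
which the tree does not construct — `PeriodRealization.IsClassical` (v1,
`Motives/PeriodRealizationClassical.lean`) pins only the Betti–Hodge layer `P.B`, not `P.dR`/`P.iso`,
so no closed `∀ P, P.IsClassical → …` form is asserted (it would claim the partner property for
every comparison datum satisfying the structure axioms, which André does not print); consumers take
`(h : P.Andre1996_deRhamPartner)` next to `P.IsClassical`. No `_holds` is owed for an abstract `P`.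
The hypothesis `IsAlgClosed k` is built into the predicate: for `k` not algebraically closed the
de Rham component of a motivated class on `X_ℂ` is in general only defined over `k̄`.

NOT rendered (vocabulary missing, as recorded in `MotivatedAutPoints.lean`): the base-change
identification `A_mot(X_k) = A_mot(X_L)` for an extension `L/k` of algebraically closed fields as
such — it compares motivated classes of one Weil cohomology over two base fields, and the tree has
no base change of a `WeilCohomology` along a field extension (only `BettiHodgeData.comap σ`, a
`PreWeilCohomology`); the Galois-invariants clause; the `ℓ`-adic components. André's Thm. 0.4
(reductive = fixator of motivated tensors) is `Andre1996_thm04_completelyReducible` /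
`Andre1996_thm04_invariantsMotivated` of `MotivatedAutPoints.lean`.

## References

* Y. André, Publ. Math. IHÉS 83 (1996): §2.3 Prop. 2.3, §2.4 (p. 17), §2.5 a) Scolie (p. 17),
  b) and Prop. 2.5.1 (p. 18). [Andre1996Motifs]
* P. Deligne, *Hodge cycles on abelian varieties*, LNM 900 (1982), Prop. 2.9, Def. 2.10.
  [Deligne1982HodgeCycles]
* J.-B. Bost, F. Charles, *Some remarks concerning the Grothendieck period conjecture*, Crelle 714
  (2016) = arXiv:1307.1045, §2.1 (classes `(α_dR, α_B)` of motivated cycles over `ℚ̄`).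
  [BostCharles2014]
-/

open CategoryTheory
open scoped TensorProduct

noncomputable section

namespace Literature.AlgebraicGeometry.Motives

namespace PeriodRealization

variable {k : Type} [Field k] [CharZero k]

/-- **André 1996, §2.5 (Scolie and Prop. 2.5.1) with §2.4 / Prop. 2.3 — motivated classes have
motivated, absolutely Hodge de Rham partners over an algebraically closed base**, as a predicate on
a period realization `P` over `k`: if `k` is algebraically closed, then for every embedding
`σ : k →+* ℂ`, every smooth projective `X₀/k` of dimension `n`, every `p` and every Betti class
`β ∈ A_motᵖ((X₀)_σ) = P.B.W.motivatedClasses n (X₀)_σ p` there is a de Rham class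
`α ∈ H²ᵖ_dR(X₀/k)` which is motivated (`α ∈ P.dR.motivatedClasses n X₀ p`), absolutely Hodge
(`P.IsAbsoluteHodge n X₀ p α`, Deligne 1982 Def. 2.10) and a de Rham partner of `β`:
`P.iso σ X₀ (2p) (1 ⊗ α) = (2πi)ᵖ • (1 ⊗ β)`. (In print: motivated cycles on `X_ℂ = (X₀)_σ` come
from motivated cycles on `X₀` over the algebraically closed `k` — Scolie 2.5 with `L = ℂ`,
`K = σ(k)` — their classes in comparable Weil cohomologies correspond under the comparison
isomorphisms — §2.4, Prop. 2.3 — and their de Rham classes are absolute Hodge — Prop. 2.5.1.)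
The printed theorem is this predicate at the classical period realization; hypothesis schema, no
`_holds` for an abstract `P` (module docstring). [cite: Andre1996Motifs, §2.5 Scolie and Prop. 2.5.1 (pp. 17–18)] -/
def Andre1996_deRhamPartner (P : PeriodRealization k) : Prop :=
  ∀ [IsAlgClosed k] (σ : k →+* ℂ) ⦃n : ℕ⦄ ⦃X₀ : SchemeOver k⦄, IsSmoothProjective n X₀ →
    ∀ (p : ℕ) (β : (P.B.comap σ).obj X₀ (2 * p)),
      β ∈ P.B.W.motivatedClasses n ((baseChangeHom σ).obj X₀) p →
        ∃ α : P.dR.obj X₀ (2 * p),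
          α ∈ P.dR.motivatedClasses n X₀ p ∧ P.IsAbsoluteHodge n X₀ p α ∧
            P.iso σ X₀ (2 * p) ((1 : AlongHom ℂ σ) ⊗ₜ[k] α) =
              twoPiI σ ^ p • ((1 : AlongHom ℂ σ) ⊗ₜ[ℚ] β)

variable {P : PeriodRealization k}

/-- Under André's partner property, a Betti motivated class on `(X₀)_σ` has a de Rham partner
over the algebraically closed `k` (the existence clause alone). [cite: Andre1996Motifs, §2.5 Scolie (p. 17)] -/
theorem Andre1996_deRhamPartner.exists_partner [IsAlgClosed k] (h : P.Andre1996_deRhamPartner)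
    (σ : k →+* ℂ) {n : ℕ} {X₀ : SchemeOver k} (hX : IsSmoothProjective n X₀) (p : ℕ)
    {β : (P.B.comap σ).obj X₀ (2 * p)}
    (hβ : β ∈ P.B.W.motivatedClasses n ((baseChangeHom σ).obj X₀) p) :
    ∃ α : P.dR.obj X₀ (2 * p),
      P.iso σ X₀ (2 * p) ((1 : AlongHom ℂ σ) ⊗ₜ[k] α) =
        twoPiI σ ^ p • ((1 : AlongHom ℂ σ) ⊗ₜ[ℚ] β) := by
  obtain ⟨α, -, -, hα⟩ := h σ hX p β hβ
  exact ⟨α, hα⟩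

/-- Under André's partner property, every Betti motivated class on `(X₀)_σ` is, up to `(2πi)ᵖ`,
the comparison image of an ABSOLUTE HODGE de Rham class on `X₀` (Prop. 2.5.1: motivated cycles
are absolutely Hodge). [cite: Andre1996Motifs, Prop. 2.5.1 (p. 18)] -/
theorem Andre1996_deRhamPartner.exists_isAbsoluteHodge [IsAlgClosed k]
    (h : P.Andre1996_deRhamPartner) (σ : k →+* ℂ) {n : ℕ} {X₀ : SchemeOver k}
    (hX : IsSmoothProjective n X₀) (p : ℕ) {β : (P.B.comap σ).obj X₀ (2 * p)}
    (hβ : β ∈ P.B.W.motivatedClasses n ((baseChangeHom σ).obj X₀) p) :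
    ∃ α : P.dR.obj X₀ (2 * p), P.IsAbsoluteHodge n X₀ p α ∧
      P.iso σ X₀ (2 * p) ((1 : AlongHom ℂ σ) ⊗ₜ[k] α) =
        twoPiI σ ^ p • ((1 : AlongHom ℂ σ) ⊗ₜ[ℚ] β) := by
  obtain ⟨α, -, hAH, hα⟩ := h σ hX p β hβ
  exact ⟨α, hAH, hα⟩

/-- Under André's partner property, a Betti motivated class on `(X₀)_σ` is a rational Hodge class
partner in Deligne's sense relative to `σ`: its de Rham partner is a Hodge class relative to `σ`
(`IsHodgeRelativeTo`, from absolute Hodge-ness at the embedding `σ`). [cite: Deligne1982HodgeCycles, Def. 2.10] -/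
theorem Andre1996_deRhamPartner.exists_isHodgeRelativeTo [IsAlgClosed k]
    (h : P.Andre1996_deRhamPartner) (σ : k →+* ℂ) {n : ℕ} {X₀ : SchemeOver k}
    (hX : IsSmoothProjective n X₀) (hXσ : IsSmoothProjective n ((baseChangeHom σ).obj X₀))
    (p : ℕ) {β : (P.B.comap σ).obj X₀ (2 * p)}
    (hβ : β ∈ P.B.W.motivatedClasses n ((baseChangeHom σ).obj X₀) p) :
    ∃ α : P.dR.obj X₀ (2 * p), P.IsHodgeRelativeTo σ hXσ p α ∧
      P.iso σ X₀ (2 * p) ((1 : AlongHom ℂ σ) ⊗ₜ[k] α) =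
        twoPiI σ ^ p • ((1 : AlongHom ℂ σ) ⊗ₜ[ℚ] β) := by
  obtain ⟨α, hAH, hα⟩ := h.exists_isAbsoluteHodge σ hX p hβ
  exact ⟨α, hAH σ hXσ, hα⟩

end PeriodRealization

end Literature.AlgebraicGeometry.Motives

end
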